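import Mathlib
import HarnessLib.Audit
import Summits.PneNP.PneNP.Theorems.PstarTwoCoreNormal
import Summits.PneNP.PneNP.Theorems.PstarCoincidenceRank

/-!
# Pair-cores are terminal sub-cores or empty-core coincidences, read by explicit path-sum descendants (ROUND-24, O1; memo g21 §17.5)

FRONTIER range-avoidance ladder, rung F-N3, ROUND 24 (cell `pnp-ideate`, prover-2 memo `g21/O1-CHORD-READ-g21.md` §17.5; typed target
`PstarCoreBoundTargets.TerminalPeelable` (p646951); restricted-model proof complexity — nothing here bears on `P` versus `NP`).

The instance `w₁ = ℓ_t = ({vars c 0, vars c 1}, ∅, t)` (bare pair-read of the chord `c`), `w₂ = R = (C, G, b)` of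
`PstarTwoCoreNormal.twoCore_normalForm`, for a PAIR-CORE `(K, ℓ_t, R)` (`PstarChordReadPairCore.PairCore`):

* `mem_lin_iff_odd` — the `ℓ`-descendant along `F` is the PATH SUM: its linear part is the set of odd vertices of the XOR multigraph `c + F`;
* **`PairCore.normalForm`** — an XOR-closed `K₀ ⊆ K`, fold sets `F₁, F₂` covering `K ∖ K₀`, `d₁` = the path sum of `ℓ_t` along `F₁`
  (monomials `F₁`; linear variables XOR-type, EVERY ONE READ BY `K₀` — typed instance), `d₂` descending from `R` by `F₂` (monomials `G ∪ F₂`),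
  (T3), (M0), (M′) for `(K₀, d₁, d₂)`; `Terminal I r y K₀ d₁ d₂` if `K₀ ≠ ∅`; and if `K₀ = ∅`: `d₁ = (∅, F₁, ·)` with `c + F₁` EVERYWHERE EVEN
  (`c` closes an XOR cycle inside `K`; the constraint is `Σ_{f ∈ F₁} Q_f = const`) and `d₁ ∧ d₂` unsatisfiable over all assignments — exactly the
  shape of the 3-cycle defects `{c, t, o}` of memo §15.2 (`Q_t ⊕ Q_o` pinned against a menu reader); moreover BOTH constraints have polar
  rank `< 6` (`rank_lt_six_of_flips`, from `PstarCoincidenceRank`: a rank-six coincidence would be a complementary pair, killed by the flip of a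
  common monomial) — so the AND-graphs of `F₁` and of `G ∪ F₂` carry no induced matching of three pairs.

Consequence for the chain (memo §17.5): at `#J₀ ≤ 12` a pair-core's terminal sub-core `K₀ ⊆ J₀ ∖ c` has `≤ 11` outputs, so Assumption A is
automatic there (`PstarChordBridgeCentre.assumptionA_of_card_lt`) and `TerminalFiveA` (O2) bounds it by five: slice genericity at `k = 12` is an
O2-type statement plus the exclusion of small terminal sub-cores / even-cycle coincidences read by these explicit descendants.  No Assumption A.
-/

set_option linter.dupNamespace false -- `Summit.PneNP.PneNP.…`: summit = sub-problem name (D-0017 single-conjunct layout)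

open Finset Module Literature.Computability.Complexity
open scoped symmDiff
open Summit.PneNP.PneNP.Theorems.PstarTyped (Typed)
open Summit.PneNP.PneNP.Theorems.PstarSALevel (varSet bdry BoundaryExpanding SimpleOverlap)
open Summit.PneNP.PneNP.Theorems.PstarGapPeeling (feasible_of_boundaryExpanding)
open Summit.PneNP.PneNP.Theorems.PstarCentreFree (vars_mem_varSet)
open Summit.PneNP.PneNP.Theorems.PstarGapOneAll (gval)
open Summit.PneNP.PneNP.Theorems.PstarGConstraint (eq_empty_of_gval_const andPairs_simple gval_false gval_nonconst_iff)
open Summit.PneNP.PneNP.Theorems.PstarGSat (gSat)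
open Summit.PneNP.PneNP.Theorems.PstarCoreBound (XorClosed)
open Summit.PneNP.PneNP.Theorems.PstarCoreBoundTargets (Terminal)
open Summit.PneNP.PneNP.Theorems.PstarChordBridgeTools (xpdeg)
open Summit.PneNP.PneNP.Theorems.PstarChordBridgeFundamental (xpdeg_insert)
open Summit.PneNP.PneNP.Theorems.PstarNorUnitAssembly (xpdeg_empty)
open Summit.PneNP.PneNP.Theorems.PstarGSystemFold (fold gval_fold_iff_of_solves)
open Summit.PneNP.PneNP.Theorems.PstarGSystemFreeVar (elimG card_elimG_lt)
open Summit.PneNP.PneNP.Theorems.PstarGapTwoTerminal (Inv inv_fold inv_elim mem_monomials)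
open Summit.PneNP.PneNP.Theorems.PstarChordReadsMirror (gval_pair)
open Summit.PneNP.PneNP.Theorems.PstarChordReadPairCore (PairCore)
open Summit.PneNP.PneNP.Theorems.PstarTwoCoreNormal
open Summit.PneNP.PneNP.Theorems.PstarQuadRank (rad)
open Summit.PneNP.PneNP.Theorems.PstarProductRank (polar)
open Summit.PneNP.PneNP.Theorems.PstarCoincidenceRank (eq_of_coincidence_of_rank_six)

namespace Summit.PneNP.PneNP.Theorems.PstarPairCoreNormal

variable {n m : ℕ}

/-! ## Pair-cores -/
section PairCoreNormal

variable {I : LocalMap 4 n m} {r : ℕ} {y : Fin m → Bool} {K : Finset (Fin m)} {c : Fin m} {t : Bool} {C : Finset (Fin n)}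
  {G : Finset (Fin m)} {b : Bool}

/-- **The `ℓ`-descendant is a path sum**: its linear part is the set of odd vertices of the XOR multigraph of `c + F`. -/
theorem mem_lin_iff_odd (hI : I.IsPure xorAndPred) {F : Finset (Fin m)} {d : Finset (Fin n) × Finset (Fin m) × Bool}
    (h : Descends I y ({I.vars c 0, I.vars c 1}, ∅, t) F d) (hcF : c ∉ F) (v : Fin n) : v ∈ d.1 ↔ Odd (xpdeg I (insert c F) v) := by
  classical
  have h01 : I.vars c 0 ≠ I.vars c 1 := fun e => absurd (hI.2 c e) (by decide)
  rw [h.2.1 v, xpdeg_insert I hcF]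
  dsimp only
  rw [mem_insert, mem_singleton]
  by_cases h0 : I.vars c 0 = v
  · have h1 : I.vars c 1 ≠ v := fun e => h01 (h0.trans e.symm)
    rw [if_pos h0, if_neg h1, add_zero, Nat.odd_add_one, Nat.not_odd_iff_even]
    have : v = I.vars c 0 ∨ v = I.vars c 1 := Or.inl h0.symm
    tauto
  · by_cases h1 : I.vars c 1 = v
    · rw [if_neg h0, if_pos h1, add_zero, Nat.odd_add_one, Nat.not_odd_iff_even]
      have : v = I.vars c 0 ∨ v = I.vars c 1 := Or.inr h1.symm
      tauto
    · rw [if_neg h0, if_neg h1, add_zero, add_zero, ← Nat.not_even_iff_odd]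
      have : ¬ (v = I.vars c 0 ∨ v = I.vars c 1) := fun h' => h'.elim (fun e => h0 e.symm) (fun e => h1 e.symm)
      tauto

/-- A vertex of odd slot-degree is an XOR slot of some output of the edge set. -/
theorem exists_xor_slot_of_odd {F : Finset (Fin m)} {v : Fin n} (hv : Odd (xpdeg I F v)) : ∃ f ∈ F, ∃ s : Fin 4, s.val < 2 ∧ I.vars f s = v := by
  classical
  have hpos : 0 < xpdeg I F v := Nat.pos_of_ne_zero fun h0 => by rw [h0] at hv; exact Nat.not_odd_zero hv
  unfold xpdeg PstarXorElimination.pdeg at hpos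
  rcases Nat.add_pos_iff_pos_or_pos.1 hpos with hp | hp
  · obtain ⟨f, hf⟩ := card_pos.1 hp
    rw [mem_filter] at hf
    exact ⟨f, hf.1, 0, by decide, hf.2⟩
  · obtain ⟨f, hf⟩ := card_pos.1 hp
    rw [mem_filter] at hf
    exact ⟨f, hf.1, 1, by decide, hf.2⟩

/-- **Rank bound for the empty-core coincidence from the flip property.**  Two G-constraints with monomial sets `F₁` and `G ∪ F₂`
(`F₁, F₂ ⊆ K` covering the non-empty `K`, `G` disjoint from `K`), jointly unsatisfiable over all assignments, with the per-monomial flip property on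
`K ∪ G`: both polar forms have rank `< 6` (`PstarCoincidenceRank.eq_of_coincidence_of_rank_six`: otherwise they are complementary with equal
monomial sets, so `G = ∅`, `F₁ = F₂ = K`, and the flip of any output of `K` violates both — impossible for a complementary pair). -/
theorem rank_lt_six_of_flips (hI : I.IsPure xorAndPred) (hS : SimpleOverlap I) {F₁ F₂ : Finset (Fin m)}
    {d₁ d₂ : Finset (Fin n) × Finset (Fin m) × Bool} (hKne : K.Nonempty) (hcov : K ⊆ F₁ ∪ F₂) (hF₁ : F₁ ⊆ K) (hF₂ : F₂ ⊆ K)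
    (hdisj : Disjoint K G) (hm₁ : d₁.2.1 = F₁) (hm₂ : d₂.2.1 = G ∪ F₂)
    (hU : ∀ z : Fin n → Bool, ¬ (gval I d₁.1 d₁.2.1 z = d₁.2.2 ∧ gval I d₂.1 d₂.2.1 z = d₂.2.2))
    (hflip : ∀ g ∈ K ∪ G, ∃ z : Fin n → Bool,
      (gval I d₁.1 d₁.2.1 z = d₁.2.2 ↔ g ∉ d₁.2.1) ∧ (gval I d₂.1 d₂.2.1 z = d₂.2.2 ↔ g ∉ d₂.2.1)) :
    finrank (ZMod 2) (Fin n → ZMod 2) < finrank (ZMod 2) (rad (polar d₁.2.1 (fun j => I.vars j 2) (fun j => I.vars j 3))) + 6 ∧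
    finrank (ZMod 2) (Fin n → ZMod 2) < finrank (ZMod 2) (rad (polar d₂.2.1 (fun j => I.vars j 2) (fun j => I.vars j 3))) + 6 := by
  classical
  -- a non-constant constraint takes its value somewhere
  have sat_of_ne : ∀ (d : Finset (Fin n) × Finset (Fin m) × Bool), d.2.1.Nonempty → ∃ z : Fin n → Bool, gval I d.1 d.2.1 z = d.2.2 := by
    intro d hd
    obtain ⟨hnd, hdist⟩ := andPairs_simple I hI hS d.2.1
    obtain ⟨z, z', hzz⟩ := (gval_nonconst_iff I hnd hdist).2 (Or.inr hd.ne_empty)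
    by_cases hz : gval I d.1 d.2.1 z = d.2.2
    · exact ⟨z, hz⟩
    · refine ⟨z', ?_⟩
      revert hz hzz
      cases gval I d.1 d.2.1 z <;> cases gval I d.1 d.2.1 z' <;> cases d.2.2 <;> decide
  -- both constraints are satisfiable
  have hS₂ : ∃ z : Fin n → Bool, gval I d₂.1 d₂.2.1 z = d₂.2.2 := by
    by_cases h : ∃ g ∈ F₁, g ∉ F₂
    · obtain ⟨g, hg₁, hg₂⟩ := h
      obtain ⟨z, -, hz₂⟩ := hflip g (mem_union_left _ (hF₁ hg₁))
      refine ⟨z, hz₂.2 ?_⟩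
      rw [hm₂, mem_union, not_or]
      exact ⟨fun hgG => disjoint_left.1 hdisj (hF₁ hg₁) hgG, hg₂⟩
    · push Not at h
      apply sat_of_ne
      obtain ⟨k, hk⟩ := hKne
      have hk₂ : k ∈ F₂ := by
        rcases mem_union.1 (hcov hk) with h' | h'
        exacts [h k h', h']
      exact ⟨k, by rw [hm₂]; exact mem_union_right _ hk₂⟩
  have hS₁ : ∃ z : Fin n → Bool, gval I d₁.1 d₁.2.1 z = d₁.2.2 := by
    by_cases h : ∃ g ∈ G ∪ F₂, g ∉ F₁
    · obtain ⟨g, hg₂, hg₁⟩ := h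
      have hgKG : g ∈ K ∪ G := by
        rcases mem_union.1 hg₂ with h' | h'
        exacts [mem_union_right _ h', mem_union_left _ (hF₂ h')]
      obtain ⟨z, hz₁, -⟩ := hflip g hgKG
      exact ⟨z, hz₁.2 (by rw [hm₁]; exact hg₁)⟩
    · push Not at h
      apply sat_of_ne
      obtain ⟨k, hk⟩ := hKne
      have hk₁ : k ∈ F₁ := by
        rcases mem_union.1 (hcov hk) with h' | h'
        exacts [h', h k (mem_union_right _ h')]
      exact ⟨k, by rw [hm₁]; exact hk₁⟩
  -- equal monomial sets are impossible: the flip of a common monomial violates both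
  have key : d₁.2.1 = d₂.2.1 → (∀ z : Fin n → Bool, gval I d₂.1 d₂.2.1 z = d₂.2.2 ↔ gval I d₁.1 d₁.2.1 z ≠ d₁.2.2) → False := by
    intro heq hpt
    rw [hm₁, hm₂] at heq
    obtain ⟨k, hk⟩ := hKne
    have hk₁ : k ∈ F₁ := by
      rcases mem_union.1 (hcov hk) with h' | h'
      · exact h'
      · rw [heq]; exact mem_union_right _ h'
    obtain ⟨z, hz₁, hz₂⟩ := hflip k (mem_union_left _ hk)
    have h1 : gval I d₁.1 d₁.2.1 z ≠ d₁.2.2 := fun h' => (hz₁.1 h') (by rw [hm₁]; exact hk₁)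
    have h2 : gval I d₂.1 d₂.2.1 z ≠ d₂.2.2 := fun h' => (hz₂.1 h') (by rw [hm₂, ← heq]; exact hk₁)
    exact h2 ((hpt z).2 h1)
  constructor
  · by_contra hge
    push Not at hge
    obtain ⟨-, heq, hpt⟩ := eq_of_coincidence_of_rank_six hI hS hU hS₂ hge
    exact key heq hpt
  · by_contra hge
    push Not at hge
    obtain ⟨-, heq, hpt⟩ := eq_of_coincidence_of_rank_six hI hS (fun z h => hU z ⟨h.2, h.1⟩) hS₁ hge
    refine key heq.symm fun z => ?_
    have h := hpt z
    constructor
    · intro h2 h1; exact (h.1 h1) h2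
    · intro h1
      by_contra h2
      exact h1 (h.2 h2)

/-- **THE NORMAL FORM OF A PAIR-CORE.**  Pure typed `(r,3/2)`-expanding instance with simple overlaps; a pair-core `(K, ℓ_t, R)` of the chord `c ∉ K`
at slice value `t` for the reader `R = (C, G, b)` with `G` disjoint from `K`, `#K < r`, `#(K ∪ G) ≤ r`.  THEN there are an XOR-closed `K₀ ⊆ K`, fold
sets `F₁, F₂ ⊆ K ∖ K₀` covering `K ∖ K₀` and distinct constraints `d₁, d₂` with:
* `d₁` the PATH SUM of `ℓ_t` along `F₁`: monomials `F₁`, linear part = the odd vertices of `c + F₁` (XOR-type variables, every one read by `K₀`),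
  holding on solutions of `F₁` iff `x_{vars c 0} ⊕ x_{vars c 1} = t`;
* `d₂` descending from `R` by `F₂` (monomials `G ∪ F₂`), its linear variables read by `K₀` or AND slots of monomials of `d₁, d₂`;
* (T3), (M0) and the flip property for `(K₀, d₁, d₂)`; `Terminal I r y K₀ d₁ d₂` if `K₀ ≠ ∅`;
* if `K₀ = ∅`: `d₁ = (∅, F₁, ·)` with `c + F₁` everywhere even (`c` closes an XOR cycle inside `K`), and `d₁ ∧ d₂` is unsatisfiable over all
  assignments (the EMPTY-CORE COINCIDENCE). -/
theorem PairCore.normalForm (hI : I.IsPure xorAndPred) (hT : Typed I) (hS : SimpleOverlap I) (hB : BoundaryExpanding r I)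
    (h : PairCore I y K c t (C, G, b)) (hKr : K.card < r) (hcK : c ∉ K) (hdisj : Disjoint K G) (hr : (K ∪ G).card ≤ r) :
    ∃ (K₀ F₁ F₂ : Finset (Fin m)) (d₁ d₂ : Finset (Fin n) × Finset (Fin m) × Bool),
      K₀ ⊆ K ∧ F₁ ⊆ K \ K₀ ∧ F₂ ⊆ K \ K₀ ∧ K \ K₀ ⊆ F₁ ∪ F₂ ∧ d₁ ≠ d₂ ∧
      d₁.2.1 = F₁ ∧ (∀ v, v ∈ d₁.1 ↔ Odd (xpdeg I (insert c F₁) v)) ∧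
      (∀ z : Fin n → Bool, (∀ f ∈ F₁, I.eval z f = y f) →
        (gval I d₁.1 d₁.2.1 z = d₁.2.2 ↔ xor (z (I.vars c 0)) (z (I.vars c 1)) = t)) ∧
      Descends I y (C, G, b) F₂ d₂ ∧ XorClosed I K₀ ∧
      (∀ v ∈ d₁.1, ∃ f ∈ K₀, v ∈ varSet I f) ∧
      (∀ v ∈ d₂.1, (∃ f ∈ K₀, v ∈ varSet I f) ∨ ∃ g ∈ d₁.2.1 ∪ d₂.2.1, I.vars g 2 = v ∨ I.vars g 3 = v) ∧
      (¬ ∃ z : Fin n → Bool, (∀ j ∈ K₀, I.eval z j = y j) ∧ gval I d₁.1 d₁.2.1 z = d₁.2.2 ∧ gval I d₂.1 d₂.2.1 z = d₂.2.2) ∧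
      (∀ f ∈ K₀, ∃ z : Fin n → Bool, (∀ j ∈ K₀.erase f, I.eval z j = y j) ∧ gval I d₁.1 d₁.2.1 z = d₁.2.2 ∧
        gval I d₂.1 d₂.2.1 z = d₂.2.2) ∧
      (∀ g ∈ (K \ K₀) ∪ G, ∃ z : Fin n → Bool, (∀ j ∈ K₀, I.eval z j = y j) ∧
        (gval I d₁.1 d₁.2.1 z = d₁.2.2 ↔ g ∉ d₁.2.1) ∧ (gval I d₂.1 d₂.2.1 z = d₂.2.2 ↔ g ∉ d₂.2.1)) ∧
      (K₀.Nonempty → Terminal I r y K₀ d₁ d₂) ∧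
      (K₀ = ∅ → d₁.1 = ∅ ∧ (∀ v, Even (xpdeg I (insert c F₁) v)) ∧
        (∀ z : Fin n → Bool, ¬ (gval I d₁.1 d₁.2.1 z = d₁.2.2 ∧ gval I d₂.1 d₂.2.1 z = d₂.2.2)) ∧
        finrank (ZMod 2) (Fin n → ZMod 2) < finrank (ZMod 2) (rad (polar d₁.2.1 (fun j => I.vars j 2) (fun j => I.vars j 3))) + 6 ∧
        finrank (ZMod 2) (Fin n → ZMod 2) < finrank (ZMod 2) (rad (polar d₂.2.1 (fun j => I.vars j 2) (fun j => I.vars j 3))) + 6) := by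
  classical
  have h01 : I.vars c 0 ≠ I.vars c 1 := fun e => absurd (hI.2 c e) (by decide)
  obtain ⟨hKne, hT3, hM0, -, hfeas⟩ := h
  -- the pair-read as a G-constraint
  set ℓ : Finset (Fin n) × Finset (Fin m) × Bool := ({I.vars c 0, I.vars c 1}, ∅, t) with hℓ
  have hℓval : ∀ z : Fin n → Bool, gval I ℓ.1 ℓ.2.1 z = ℓ.2.2 ↔ xor (z (I.vars c 0)) (z (I.vars c 1)) = t := fun z => by
    rw [hℓ]; dsimp only; rw [gval_pair I h01]
  have hd₁ : Disjoint K ℓ.2.1 := by rw [hℓ]; exact disjoint_empty_right _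
  have hr' : (K ∪ ℓ.2.1 ∪ (C, G, b).2.1).card ≤ r := by rw [hℓ]; dsimp only; rwa [union_empty]
  have hT3' : ¬ ∃ z : Fin n → Bool, (∀ j ∈ K, I.eval z j = y j) ∧ gval I ℓ.1 ℓ.2.1 z = ℓ.2.2 ∧
      gval I (C, G, b).1 (C, G, b).2.1 z = (C, G, b).2.2 := by
    rintro ⟨z, hz, hz₁, hz₂⟩
    exact hT3 ⟨z, hz, (hℓval z).1 hz₁, hz₂⟩
  have hM0' : ∀ f ∈ K, ∃ z : Fin n → Bool, (∀ j ∈ K.erase f, I.eval z j = y j) ∧ gval I ℓ.1 ℓ.2.1 z = ℓ.2.2 ∧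
      gval I (C, G, b).1 (C, G, b).2.1 z = (C, G, b).2.2 := fun f hf => by
    obtain ⟨z, hz, hz₁, hz₂⟩ := hM0 f hf
    exact ⟨z, hz, (hℓval z).2 hz₁, hz₂⟩
  have hflip : ∀ g ∈ ℓ.2.1 ∪ (C, G, b).2.1, ∃ z : Fin n → Bool, (∀ j ∈ K, I.eval z j = y j) ∧
      (gval I ℓ.1 ℓ.2.1 z = ℓ.2.2 ↔ g ∉ ℓ.2.1) ∧ (gval I (C, G, b).1 (C, G, b).2.1 z = (C, G, b).2.2 ↔ g ∉ (C, G, b).2.1) := by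
    intro g hg
    have hgG : g ∈ G := by
      rw [hℓ] at hg; dsimp only at hg; rwa [empty_union] at hg
    obtain ⟨z, hz, hzs⟩ := hfeas
    have hzR : gval I C G z ≠ b := fun hzR => hT3 ⟨z, hz, hzs, hzR⟩
    refine ⟨z, hz, ?_, ?_⟩
    · rw [hℓval z, hℓ]; dsimp only
      simp only [notMem_empty, not_false_eq_true, iff_true]
      exact hzs
    · dsimp only
      simp only [hgG, not_true_eq_false, iff_false]
      exact hzR
  obtain ⟨K₀, F₁, F₂, d₁, d₂, hK₀, hF₁, hF₂, hcov, hne, hD₁, hD₂, hX, hT2, hT3'', hM0'', hflip', hterm, hempty⟩ :=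
    twoCore_normalForm hI hT hS hB hKne hKr hd₁ hdisj hr' hT3' hM0' hflip
  have hcF₁ : c ∉ F₁ := fun h' => hcK (mem_sdiff.1 (hF₁ h')).1
  have hlin : ∀ v, v ∈ d₁.1 ↔ Odd (xpdeg I (insert c F₁) v) := mem_lin_iff_odd hI hD₁ hcF₁
  -- linear variables of `d₁` are XOR-type, hence read by the core
  have hread : ∀ v ∈ d₁.1, ∃ f ∈ K₀, v ∈ varSet I f := by
    intro v hv
    rcases hT2 v (mem_union_left _ hv) with h' | ⟨g, -, hg⟩
    · exact h'
    · exfalso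
      obtain ⟨f, -, s, hs, hfs⟩ := exists_xor_slot_of_odd ((hlin v).1 hv)
      rcases hg with hg | hg
      · exact hT f g s 2 hs (by decide) (hfs.trans hg.symm)
      · exact hT f g s 3 hs (by decide) (hfs.trans hg.symm)
  have hmono₁ : d₁.2.1 = F₁ := by rw [hD₁.1, hℓ]; dsimp only; rw [empty_union]
  refine ⟨K₀, F₁, F₂, d₁, d₂, hK₀, hF₁, hF₂, hcov, hne, hmono₁, hlin, fun z hz => (hD₁.2.2 z hz).trans (hℓval z), hD₂, hX, hread,
    fun v hv => hT2 v (mem_union_right _ hv), hT3'', hM0'', fun g hg => hflip' g ?_, hterm, fun hK₀e => ⟨?_, ?_, hempty hK₀e, ?_⟩⟩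
  · rcases mem_union.1 hg with hg | hg
    · exact mem_union_left _ hg
    · exact mem_union_right _ (mem_union_right _ hg)
  · rw [eq_empty_iff_forall_notMem]
    intro v hv
    obtain ⟨f, hf, -⟩ := hread v hv
    rw [hK₀e] at hf
    exact notMem_empty f hf
  · intro v
    rw [← Nat.not_odd_iff_even, ← hlin v]
    intro hv
    obtain ⟨f, hf, -⟩ := hread v hv
    rw [hK₀e] at hf
    exact notMem_empty f hf
  · -- rank bounds: the flip property on `K ∪ G` (here `K ∖ K₀ = K`)
    have hcov' : K ⊆ F₁ ∪ F₂ := fun k hk => hcov (by rw [hK₀e, sdiff_empty]; exact hk)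
    have hF₁' : F₁ ⊆ K := fun f hf => (mem_sdiff.1 (hF₁ hf)).1
    have hF₂' : F₂ ⊆ K := fun f hf => (mem_sdiff.1 (hF₂ hf)).1
    refine rank_lt_six_of_flips hI hS hKne hcov' hF₁' hF₂' hdisj hmono₁ hD₂.1 (hempty hK₀e) fun g hg => ?_
    have hg' : g ∈ K \ K₀ ∪ (ℓ.2.1 ∪ (C, G, b).2.1) := by
      rw [hK₀e, sdiff_empty, hℓ]
      dsimp only
      rw [empty_union]
      exact hg
    obtain ⟨z, -, hz⟩ := hflip' g hg'
    exact ⟨z, hz⟩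

end PairCoreNormal

end Summit.PneNP.PneNP.Theorems.PstarPairCoreNormal
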